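import Mathlib
import Literature.NumberTheory.LFunctions.Zhang2022.Section12Eq128SharpReduction
import Literature.NumberTheory.LFunctions.Zhang2022.Section12SjWindowBound
import HarnessLib

/-!
# Zhang (2022) §12 (12.8) HOLDS: the sharp core `S_j(𝐬̄,𝐬) = o(α𝔞)` by the window engine, and
# `Typed.Sec12A.Eq128 c′` for every sufficiently large `c′`

Topic `Literature/NumberTheory/LFunctions/Zhang2022` (Landau–Siegel audit tree; verdict-neutral).
Y. Zhang, *Discrete mean estimates and the Landau–Siegel zero*, arXiv:2211.02515v1 (2022)
[Zhang2022LandauSiegel], §12 p. 67, (12.8) — **an unrefereed manuscript under adjudication;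
nothing here asserts or denies its Theorems 1–2.** THEOREMS ONLY; 0 definitions, 0 facts
(ZHANG-L lane; skeleton binder `h128 : ∀ c′ ≥ c₁, Typed.Sec12A.Eq128 c′` of
`theorem1_of_leaves_v23+` (RT-06); row G-d42-3).

The last open input of (12.8) after `eq128_of_sharpCore` (tree, `Section12Eq128SharpReduction`)
is the SHARP CORE: `‖S_j(𝐬̄,𝐬)‖ = o(α𝔞)` for
`s(n) = (0.004/0.504)χ(n)(n/P″₁)^{β₆}(g(P″₂/n) − 1_{n<P″₂})·1_{P″₂η₋≤n<P″₂η₊}` (`|s| ≤ 1`, one window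
of relative width `e^{2𝓛⁻¹⁰}` at `P″₂`). This is an ABSOLUTE-VALUE estimate — no character
cancellation is available on so short a window, and none is needed: zl-w11-p5's window-coupled
counting bound `XiZeroMajorant.norm_Sj_window_le` (`Section12SjWindowBound`; engine
`SjWindowEngine.window_triple_sum_le`) gives, for sequences bounded by `1` on the window
`(Y, Y(1+δ)]` with `Y = P″₂e^{−2𝓛⁻¹⁰}`, `δ = e^{3𝓛⁻¹⁰} − 1 ∈ [3𝓛⁻¹⁰, 6𝓛⁻¹⁰]`,
`‖S_j‖ ≤ E_w·(2δ(δ(1 + log 2Y) + 2) + 4δ(1 + log(2/δ)) + 16/√(δY)) ≤ 700·E_w·𝓛⁻¹⁰√𝓛 = o(α)`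
(`log 2Y ≤ 𝓛⁹`, `log(2/δ) ≤ 10 log 𝓛 ≤ 20√𝓛`, `δY ≥ 𝓛²⁰`; `α = π𝓛⁻⁹`, `𝔞 ≫ 1`).

* `sharpCore_small` — the sharp core, for every `c′`;
* `sjDual_small` — hence the window estimate `hS′` of `eq128_of_sj_small` (row G-d42-3 (ii)) HOLDS;
* `eq128_of_inputs` — **(12.8) `Typed.Sec12A.Eq128 c′` from Prop. 2.2 (i), Lemma 2.3, Lemma 8.1,
  Prop. 7.1 only** (all in scope in the skeleton), for every `c′`;
* `eq128_holds` — `∃ c₀ ≥ 0, ∀ c′ ≥ c₀, Typed.Sec12A.Eq128 c′`, no hypothesis (START-HERE §4 closer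
  shape for the binder `h128`).

The (12.8) chain of record: `Section12Htilde15AFE*`/`Section11AFEWide*` (H̃₁₅-AFE, zl-libB-p8,
zl-w12-p4) → `Section12E2ShiftMeanSquare`, `Section8DiscreteMeanSquare`, `Section12Eq128Reduction`
(zl-libB-p4) → `Section12Eq128OfSjDual` → `Section12Eq128Coefficients`, `Section12Eq128SharpReduction`
(zl-libB-p4; engines `Section11SjTrueSizeBound` zl-w11-p2, `Section11WindowSj` zl-w11-p4,
`Section7SjBilinear`) → this file (engine `Section12SjWindowBound` zl-w11-p5).

## References

* Y. Zhang, arXiv:2211.02515v1 (2022), §12 (12.8) p. 67; §7 Prop. 7.1; §11 p. 64.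
  [cite: Zhang2022LandauSiegel, §12 (12.8) p.67]
-/

noncomputable section

open Complex Real ComplexConjugate

namespace Literature.NumberTheory.LFunctions.Zhang2022.Typed.Sec12A

open Skeleton

/-! ## §1. Sizes of the window parameters -/

/-- For `D ≥ ⌈e^M⌉`, `𝓛 = log D ≥ M`. [cite: Zhang2022LandauSiegel, §2 p.4] -/
private theorem le_ell_of_ceil_exp_le₃ {M : ℝ} {D : ℕ} (hD : ⌈Real.exp M⌉₊ ≤ D) : M ≤ ell D := by
  have h : Real.exp M ≤ D := le_trans (Nat.le_ceil _) (by exact_mod_cast hD)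
  exact (Real.le_log_iff_exp_le (lt_of_lt_of_le (Real.exp_pos _) h)).mpr h

/-- `log x ≤ 2√x` for `x > 0`. [folklore] -/
private theorem log_le_two_sqrt {x : ℝ} (hx : 0 < x) : Real.log x ≤ 2 * Real.sqrt x := by
  have hs : 0 < Real.sqrt x := Real.sqrt_pos.mpr hx
  have h1 : Real.log (Real.sqrt x) ≤ Real.sqrt x - 1 := Real.log_le_sub_one_of_pos hs
  have h2 : Real.log (Real.sqrt x) = Real.log x / 2 := Real.log_sqrt hx.le
  linarith

/-- The window parameters: `δ = e^{3𝓛⁻¹⁰} − 1` satisfies `3𝓛⁻¹⁰ ≤ δ ≤ 6𝓛⁻¹⁰`, `0 < δ ≤ 1` (`𝓛 ≥ 2`).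
[cite: Zhang2022LandauSiegel, §12 p.67] -/
theorem delta_bounds {D : ℕ} (hℓ2 : 2 ≤ ell D) :
    3 * (ell D ^ 10)⁻¹ ≤ etaPM D 3 - 1 ∧ etaPM D 3 - 1 ≤ 6 * (ell D ^ 10)⁻¹ ∧
      0 < etaPM D 3 - 1 ∧ etaPM D 3 - 1 ≤ 1 := by
  have hℓ : 0 < ell D := by linarith
  have hm : 0 < (ell D ^ 10)⁻¹ := inv_pos.mpr (pow_pos hℓ 10)
  have hm_small : (ell D ^ 10)⁻¹ ≤ 1 / 1024 := by
    have h10 : (1024 : ℝ) ≤ ell D ^ 10 := by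
      have h := pow_le_pow_left₀ (by norm_num : (0 : ℝ) ≤ 2) hℓ2 10
      norm_num at h; exact h
    rw [one_div]; exact inv_anti₀ (by norm_num) h10
  have hlow : 3 * (ell D ^ 10)⁻¹ ≤ etaPM D 3 - 1 := by
    rw [etaPM]; linarith [Real.add_one_le_exp (3 * (ell D ^ 10)⁻¹)]
  have hup : etaPM D 3 - 1 ≤ 6 * (ell D ^ 10)⁻¹ := by
    rw [etaPM]
    have h := Real.abs_exp_sub_one_le (x := 3 * (ell D ^ 10)⁻¹)
      (by rw [abs_of_pos (by positivity)]; linarith)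
    rw [abs_of_pos (by positivity : (0 : ℝ) < 3 * (ell D ^ 10)⁻¹)] at h
    linarith [le_abs_self (Real.exp (3 * (ell D ^ 10)⁻¹) - 1)]
  exact ⟨hlow, hup, lt_of_lt_of_le (by positivity) hlow, by linarith⟩

/-! ## §2. The sharp core -/

section Core

/-- **The sharp core `S_j(𝐬̄,𝐬) = o(α𝔞)`** (for every `c′`): for every `ε > 0`, eventually
under (A), `‖S_j(𝐬̄,𝐬)‖ ≤ ε·α·𝔞` (`j = 1,2,3`), by the window bound
`XiZeroMajorant.norm_Sj_window_le` at `B₁ = B₂ = 1`, `Y = Y' = P″₂e^{−2𝓛⁻¹⁰}`,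
`δ = δ' = e^{3𝓛⁻¹⁰} − 1` and `𝔞 ≫ 1` (`Skeleton.frakALowerBound_holds`).
[cite: Zhang2022LandauSiegel, §12 (12.8) p.67; §11 p.64] -/
theorem sharpCore_small (c' : ℝ) :
    ∀ ε : ℝ, 0 < ε → ForAllLarge fun D _ χ => AssumptionA D χ →
      ∀ j ∈ ({1, 2, 3} : Finset ℕ),
        ‖Sj c' D j (fun n : ℕ => conj (if P2pp D * etaPM D (-1) ≤ n ∧ (n : ℝ) < P2pp D * etaPM D 1 then
          ((0.004 / 0.504 : ℝ) : ℂ) * χ (n : ZMod D) * (((n : ℝ) / P1pp D : ℝ) : ℂ) ^ beta6 D *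
            ((gW D (P2pp D / n) - (if (n : ℝ) < P2pp D then 1 else 0) : ℝ) : ℂ)
        else 0)) (fun n : ℕ => (if P2pp D * etaPM D (-1) ≤ n ∧ (n : ℝ) < P2pp D * etaPM D 1 then
          ((0.004 / 0.504 : ℝ) : ℂ) * χ (n : ZMod D) * (((n : ℝ) / P1pp D : ℝ) : ℂ) ^ beta6 D *
            ((gW D (P2pp D / n) - (if (n : ℝ) < P2pp D then 1 else 0) : ℝ) : ℂ)
        else 0))‖ ≤ ε * alpha D * frakA χ := by
  intro ε hε
  obtain ⟨a₀, ha₀, D₀, hA⟩ := frakALowerBound_holds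
  have hEw := XiZeroMajorant.Ew_nonneg
  set M : ℝ := max ((700 * XiZeroMajorant.Ew / (ε * π * a₀)) ^ 2) 5 with hMdef
  refine ⟨max (max D₀ ⌈Real.exp (5 * |c'| * π + 3)⌉₊) ⌈Real.exp M⌉₊,
    fun D _ χ hD hq hp hAss j hj => ?_⟩
  have hD₀ : D₀ ≤ D := le_trans (le_trans (le_max_left _ _) (le_max_left _ _)) hD
  have hDT : ⌈Real.exp (5 * |c'| * π + 3)⌉₊ ≤ D := le_trans (le_trans (le_max_right _ _) (le_max_left _ _)) hD
  have hMℓ : M ≤ ell D := le_ell_of_ceil_exp_le₃ (le_trans (le_max_right _ _) hD)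
  have hℓ5 : 5 ≤ ell D := le_trans (le_max_right _ _) hMℓ
  have hℓ : 0 < ell D := by linarith
  have hℓ1 : 1 ≤ ell D := by linarith
  have hℓ2 : 2 ≤ ell D := by linarith
  have hD1 : 1 ≤ Real.log D := by rw [← ell]; linarith
  have hsq : (700 * XiZeroMajorant.Ew / (ε * π * a₀)) ^ 2 ≤ ell D := le_trans (le_max_left _ _) hMℓ
  have ha : a₀ ≤ frakA χ := hA D χ hD₀ hq hp hAss
  have hα : alpha D = π / ell D ^ 9 := by rw [alpha, bigP, Real.log_exp]
  have hP1pp := Sec12D.P1pp_pos hD1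
  have hP2pp := Sec12D.P2pp_pos hD1
  -- the window parameters
  obtain ⟨hδlo, hδhi, hδ0, hδ1⟩ := delta_bounds hℓ2
  set δ : ℝ := etaPM D 3 - 1 with hδdef
  set m : ℝ := (ell D ^ 10)⁻¹ with hmdef
  have hm : 0 < m := inv_pos.mpr (pow_pos hℓ 10)
  set Y : ℝ := P2pp D * etaPM D (-2) with hYdef
  have hη : ∀ a : ℝ, 0 < etaPM D a := fun a => Real.exp_pos _
  have hY0 : 0 < Y := mul_pos hP2pp (hη _)
  -- `P″₂ ≥ e^{𝓛⁹/2}`, `Y ≥ e^{𝓛⁹/2 − 1} ≥ 1`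
  have hP2ge : Real.exp (ell D ^ 9 / 2) ≤ P2pp D := by
    have hD1' : (1 : ℝ) ≤ D := by
      have := Sec12D.natCast_eq_exp_ell hD1
      rw [this]; exact Real.one_le_exp hℓ.le
    have ht1 : 1 ≤ t0 D := one_le_pow₀ hℓ1
    rw [P2pp, bigP, ← Real.exp_mul, show ell D ^ 9 * (0.5 : ℝ) = ell D ^ 9 / 2 by ring]
    calc Real.exp (ell D ^ 9 / 2) = Real.exp (ell D ^ 9 / 2) * 1 * 1 := by ring
      _ ≤ Real.exp (ell D ^ 9 / 2) * D * t0 D := by gcongr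
  have hYge : Real.exp (ell D ^ 9 / 2 - 1) ≤ Y := by
    rw [hYdef, Real.exp_sub, div_eq_mul_inv, etaPM]
    refine mul_le_mul hP2ge ?_ (by positivity) hP2pp.le
    rw [← Real.exp_neg]
    exact Real.exp_le_exp.mpr (by
      have : m ≤ 1 / 1024 := by
        have h10 : (1024 : ℝ) ≤ ell D ^ 10 := by
          have h := pow_le_pow_left₀ (by norm_num : (0 : ℝ) ≤ 2) hℓ2 10
          norm_num at h; exact h
        rw [hmdef, one_div]; exact inv_anti₀ (by norm_num) h10
      linarith)
  have h9 : (1953125 : ℝ) ≤ ell D ^ 9 := by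
    have := pow_le_pow_left₀ (by norm_num : (0 : ℝ) ≤ 5) hℓ5 9; norm_num at this; exact this
  have hy0 : 0 ≤ ell D ^ 9 / 2 - 1 := by linarith
  have hY1 : 1 ≤ Y := le_trans (Real.one_le_exp hy0) hYge
  -- the sequence is bounded by `1` on the window `(Y, Y(1+δ)]` and vanishes off it
  have hwin : ∀ n : ℕ, P2pp D * etaPM D (-1) ≤ n ∧ (n : ℝ) < P2pp D * etaPM D 1 →
      Y < n ∧ (n : ℝ) ≤ Y * (1 + δ) := by
    intro n hn
    constructor
    · have : Y < P2pp D * etaPM D (-1) := by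
        rw [hYdef]; exact mul_lt_mul_of_pos_left (etaPM_lt_etaPM hℓ (by norm_num)) hP2pp
      linarith [hn.1]
    · have : Y * (1 + δ) = P2pp D * etaPM D 1 := by
        rw [hYdef, hδdef, add_sub_cancel, mul_assoc, etaPM_mul]; norm_num
      rw [this]; exact hn.2.le
  have hbound : ∀ n : ℕ, ‖(fun n : ℕ => (if P2pp D * etaPM D (-1) ≤ n ∧ (n : ℝ) < P2pp D * etaPM D 1 then
          ((0.004 / 0.504 : ℝ) : ℂ) * χ (n : ZMod D) * (((n : ℝ) / P1pp D : ℝ) : ℂ) ^ beta6 D *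
            ((gW D (P2pp D / n) - (if (n : ℝ) < P2pp D then 1 else 0) : ℝ) : ℂ)
        else 0)) n‖ ≤
      if Y < (n : ℝ) ∧ (n : ℝ) ≤ Y * (1 + δ) then (1 : ℝ) else 0 := by
    intro n
    by_cases hs : P2pp D * etaPM D (-1) ≤ n ∧ (n : ℝ) < P2pp D * etaPM D 1
    · rw [if_pos (hwin n hs)]
      have hn : 1 ≤ n := by
        have : (0 : ℝ) < n := lt_of_lt_of_le (mul_pos hP2pp (hη _)) hs.1
        exact_mod_cast this
      calc _ ≤ 0.002 / 0.504 * Real.exp (-(ell D ^ 30) * (Real.log (P2pp D / n)) ^ 2) :=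
            norm_sharp_le χ hD1 hn
        _ ≤ 0.002 / 0.504 * 1 := by
            refine mul_le_mul_of_nonneg_left ?_ (by norm_num)
            rw [Real.exp_le_one_iff]
            exact mul_nonpos_of_nonpos_of_nonneg (neg_nonpos.mpr (pow_pos hℓ 30).le) (sq_nonneg _)
        _ ≤ 1 := by norm_num
    · simp only [hs, if_false, norm_zero]
      split_ifs <;> norm_num
  have hbound' : ∀ n : ℕ, ‖(fun n : ℕ => conj (if P2pp D * etaPM D (-1) ≤ n ∧ (n : ℝ) < P2pp D * etaPM D 1 then
          ((0.004 / 0.504 : ℝ) : ℂ) * χ (n : ZMod D) * (((n : ℝ) / P1pp D : ℝ) : ℂ) ^ beta6 D *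
            ((gW D (P2pp D / n) - (if (n : ℝ) < P2pp D then 1 else 0) : ℝ) : ℂ)
        else 0)) n‖ ≤
      if Y < (n : ℝ) ∧ (n : ℝ) ≤ Y * (1 + δ) then (1 : ℝ) else 0 := by
    intro n
    have := hbound n
    simp only at this ⊢
    rw [RCLike.norm_conj]; exact this
  -- the window engine
  have hS := XiZeroMajorant.norm_Sj_window_le hDT j zero_le_one zero_le_one hY1 hY1 hδ0 hδ1 hδ0 hδ1
    hbound' hbound
  refine hS.trans ?_
  -- sizes of the three engine terms
  have hlog2Y : Real.log (2 * Y) ≤ ell D ^ 9 := by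
    -- `2Y ≤ 2P″₂ ≤ P = e^{𝓛⁹}`
    have h2Y : 2 * Y ≤ bigP D := by
      have hYle : Y ≤ P2pp D := by
        rw [hYdef]
        refine mul_le_of_le_one_right hP2pp.le ?_
        rw [etaPM]; exact Real.exp_le_one_iff.mpr (by nlinarith [hm])
      have hP2 : P2pp D ≤ Real.exp (0.5 * ell D ^ 9 + 520 * ell D) := by
        rw [P2pp, Sec12D.natCast_eq_exp_ell hD1, bigP, ← Real.exp_mul,
          show 0.5 * ell D ^ 9 + 520 * ell D = (ell D ^ 9 * 0.5 + ell D) + 519 * ell D by ring,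
          Real.exp_add, Real.exp_add]
        exact mul_le_mul_of_nonneg_left (Sec12D.t0_le_exp hD1) (by positivity)
      have h2 : (2 : ℝ) ≤ Real.exp 1 := by have := Real.add_one_le_exp (1 : ℝ); linarith
      calc 2 * Y ≤ Real.exp 1 * Real.exp (0.5 * ell D ^ 9 + 520 * ell D) :=
            mul_le_mul h2 (hYle.trans hP2) hY0.le (Real.exp_pos _).le
        _ = Real.exp (0.5 * ell D ^ 9 + 520 * ell D + 1) := by rw [← Real.exp_add]; ring_nf
        _ ≤ bigP D := by
            rw [bigP, Real.exp_le_exp]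
            have h8 : (4 : ℝ) ^ 8 ≤ ell D ^ 8 := pow_le_pow_left₀ (by norm_num) (by linarith) 8
            have h9 : ell D * (4 : ℝ) ^ 8 ≤ ell D * ell D ^ 8 := mul_le_mul_of_nonneg_left h8 hℓ.le
            have e9 : ell D ^ 9 = ell D * ell D ^ 8 := by ring
            rw [e9]; norm_num at h9 ⊢; linarith only [h9, hℓ5]
    calc Real.log (2 * Y) ≤ Real.log (bigP D) := Real.log_le_log (by positivity) h2Y
      _ = ell D ^ 9 := log_bigP D
  have hlogδ : Real.log (2 / δ) ≤ 20 * Real.sqrt (ell D) := by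
    have h1 : 2 / δ ≤ ell D ^ 10 := by
      rw [div_le_iff₀ hδ0]
      have : ell D ^ 10 * (3 * (ell D ^ 10)⁻¹) = 3 := by field_simp
      nlinarith [hδlo, pow_pos hℓ 10]
    calc Real.log (2 / δ) ≤ Real.log (ell D ^ 10) := Real.log_le_log (by positivity) h1
      _ = 10 * Real.log (ell D) := by rw [Real.log_pow]; norm_num
      _ ≤ 10 * (2 * Real.sqrt (ell D)) := by gcongr; exact log_le_two_sqrt hℓ
      _ = 20 * Real.sqrt (ell D) := by ring
  have htail : 16 / Real.sqrt (δ * Y) ≤ 16 * (ell D ^ 10)⁻¹ := by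
    -- `δY ≥ 3𝓛⁻¹⁰·e^{𝓛⁹/2−1} ≥ 𝓛²⁰`
    have hexp : (ell D ^ 9 / 2 - 1) ^ 4 / 24 ≤ Real.exp (ell D ^ 9 / 2 - 1) := by
      have h := Real.pow_div_factorial_le_exp (ell D ^ 9 / 2 - 1) hy0 4
      have h4 : ((4 : ℕ).factorial : ℝ) = 24 := by norm_num [Nat.factorial]
      rwa [h4] at h
    have hy : ell D ^ 9 / 4 ≤ ell D ^ 9 / 2 - 1 := by linarith
    have h4 : (ell D ^ 9 / 4) ^ 4 ≤ (ell D ^ 9 / 2 - 1) ^ 4 := pow_le_pow_left₀ (by positivity) hy 4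
    have h6 : (15625 : ℝ) ≤ ell D ^ 6 := by
      have := pow_le_pow_left₀ (by norm_num : (0 : ℝ) ≤ 5) hℓ5 6; norm_num at this; exact this
    have hE : ell D ^ 30 / 3 ≤ Real.exp (ell D ^ 9 / 2 - 1) := by
      calc ell D ^ 30 / 3 = ell D ^ 30 * 2048 / 6144 := by ring
        _ ≤ ell D ^ 30 * ell D ^ 6 / 6144 := by gcongr; linarith
        _ = (ell D ^ 9 / 4) ^ 4 / 24 := by ring
        _ ≤ (ell D ^ 9 / 2 - 1) ^ 4 / 24 := by gcongr
        _ ≤ Real.exp (ell D ^ 9 / 2 - 1) := hexp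
    have hδY : ell D ^ 20 ≤ δ * Y := by
      have h1 : 3 * m * (ell D ^ 30 / 3) ≤ δ * Y :=
        mul_le_mul hδlo (hE.trans hYge) (by positivity) hδ0.le
      have h2 : 3 * m * (ell D ^ 30 / 3) = ell D ^ 20 := by
        rw [hmdef]; field_simp
      rw [h2] at h1; exact h1
    have hsqrt : ell D ^ 10 ≤ Real.sqrt (δ * Y) := by
      rw [show ell D ^ 10 = Real.sqrt ((ell D ^ 10) ^ 2) by rw [Real.sqrt_sq (by positivity)]]
      exact Real.sqrt_le_sqrt (by rw [← pow_mul]; exact hδY)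
    rw [div_eq_mul_inv]
    exact mul_le_mul_of_nonneg_left (inv_anti₀ (pow_pos hℓ 10) hsqrt) (by norm_num)
  -- the total
  have hsqrt1 : 1 ≤ Real.sqrt (ell D) := by
    rw [show (1 : ℝ) = Real.sqrt 1 by simp]; exact Real.sqrt_le_sqrt hℓ1
  have hδm : δ ≤ 6 * m := hδhi
  have hm1 : m ≤ 1 := by
    rw [hmdef]; exact inv_le_one_of_one_le₀ (one_le_pow₀ hℓ1)
  have htot : 2 * δ * (δ * (1 + Real.log (2 * Y)) + 2) + 4 * (δ * (1 + Real.log (2 / δ))) +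
      16 / Real.sqrt (δ * Y) ≤ 700 * m * Real.sqrt (ell D) := by
    have t1 : 2 * δ * (δ * (1 + Real.log (2 * Y)) + 2) ≤ 144 * m + 24 * m := by
      have h1 : 1 + Real.log (2 * Y) ≤ 2 * ell D ^ 9 := by
        have : 1 ≤ ell D ^ 9 := one_le_pow₀ hℓ1; linarith
      have h2 : δ * (1 + Real.log (2 * Y)) ≤ 6 * m * (2 * ell D ^ 9) :=
        mul_le_mul hδm h1 (by linarith [Real.log_nonneg (show (1:ℝ) ≤ 2 * Y by linarith)]) (by positivity)
      have h3 : m * ell D ^ 9 = (ell D)⁻¹ := by rw [hmdef]; field_simp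
      have h4 : (ell D)⁻¹ ≤ 1 := inv_le_one_of_one_le₀ hℓ1
      have hL0 : 0 ≤ 1 + Real.log (2 * Y) := by
        have := Real.log_nonneg (show (1:ℝ) ≤ 2 * Y by linarith); linarith
      have hA0 : 0 ≤ δ * (1 + Real.log (2 * Y)) + 2 := add_nonneg (mul_nonneg hδ0.le hL0) (by norm_num)
      calc 2 * δ * (δ * (1 + Real.log (2 * Y)) + 2) ≤ 2 * (6 * m) * (6 * m * (2 * ell D ^ 9) + 2) :=
            mul_le_mul (by linarith) (by linarith) hA0 (by positivity)
        _ = 144 * m * (m * ell D ^ 9) + 24 * m := by ring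
        _ ≤ 144 * m * 1 + 24 * m := by rw [h3]; gcongr
        _ = 144 * m + 24 * m := by ring
    have t2 : 4 * (δ * (1 + Real.log (2 / δ))) ≤ 24 * m * (1 + 20 * Real.sqrt (ell D)) := by
      have h0 : 0 ≤ 1 + Real.log (2 / δ) := by
        have : 0 ≤ Real.log (2 / δ) := Real.log_nonneg (by rw [le_div_iff₀ hδ0]; linarith)
        linarith
      calc 4 * (δ * (1 + Real.log (2 / δ))) ≤ 4 * (6 * m * (1 + 20 * Real.sqrt (ell D))) := by
            gcongr
        _ = 24 * m * (1 + 20 * Real.sqrt (ell D)) := by ring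
    have t3 : 16 / Real.sqrt (δ * Y) ≤ 16 * m := htail
    calc _ ≤ (144 * m + 24 * m) + 24 * m * (1 + 20 * Real.sqrt (ell D)) + 16 * m := by linarith
      _ = (208 + 480 * Real.sqrt (ell D)) * m := by ring
      _ ≤ (208 * Real.sqrt (ell D) + 480 * Real.sqrt (ell D)) * m := by
          gcongr; linarith [hsqrt1]
      _ = 688 * (m * Real.sqrt (ell D)) := by ring
      _ ≤ 700 * (m * Real.sqrt (ell D)) := mul_le_mul_of_nonneg_right (by norm_num) (by positivity)
      _ = 700 * m * Real.sqrt (ell D) := by ring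
  -- the threshold `√𝓛 ≥ 700E_w/(επa₀)`
  have hthr : 700 * XiZeroMajorant.Ew ≤ ε * π * a₀ * Real.sqrt (ell D) := by
    have hpos : 0 < ε * π * a₀ := by positivity
    have h1 : 700 * XiZeroMajorant.Ew / (ε * π * a₀) ≤ Real.sqrt (ell D) := Real.le_sqrt_of_sq_le hsq
    have := (div_le_iff₀ hpos).mp h1
    linarith only [this]
  calc 1 * 1 * XiZeroMajorant.Ew * (2 * δ * (δ * (1 + Real.log (2 * Y)) + 2) +
        4 * (δ * (1 + Real.log (2 / δ))) + 16 / Real.sqrt (δ * Y))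
      ≤ 1 * 1 * XiZeroMajorant.Ew * (700 * m * Real.sqrt (ell D)) :=
        mul_le_mul_of_nonneg_left htot (by positivity)
    _ = (700 * XiZeroMajorant.Ew) * Real.sqrt (ell D) * m := by ring
    _ ≤ (ε * π * a₀ * Real.sqrt (ell D)) * Real.sqrt (ell D) * m := by gcongr
    _ = ε * π * a₀ * (Real.sqrt (ell D) * Real.sqrt (ell D)) * m := by ring
    _ = ε * alpha D * a₀ := by
        rw [Real.mul_self_sqrt hℓ.le, hα, hmdef]; field_simp
    _ ≤ ε * alpha D * frakA χ := by
        rw [hα]; gcongr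

end Core

/-! ## §3. (12.8) holds -/

/-- **(12.8) `Typed.Sec12A.Eq128 c′` from Prop. 2.2 (i), Lemma 2.3, Lemma 8.1, Prop. 7.1 only**
(every `c′`; these four are terms in scope in `Skeleton.theorem1_of_leaves_v2x`): plug for the
binder `h128`. [cite: Zhang2022LandauSiegel, §12 (12.8) p.67] -/
theorem eq128_of_inputs (c' : ℝ) (h22 : Prop22i) (h23 : Lemma23 c') (h81 : Lemma81 c')
    (h71 : Prop71 c') : Eq128 c' :=
  eq128_of_sharpCore c' h22 h23 h81 h71 (sharpCore_small c')

/-- **(12.8) holds outright for every sufficiently large `c′`**: `∃ c₀ ≥ 0, ∀ c′ ≥ c₀, Eq128 c′`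
(Lemma 2.3 / Lemma 8.1 by `Skeleton.partOne_eventually`, Prop. 2.2 (i) by
`Skeleton.prop22i_holds`, Prop. 7.1 by `Section7cStatements.prop71X_holds`).
[cite: Zhang2022LandauSiegel, §12 (12.8) p.67] -/
theorem eq128_holds : ∃ c₀ : ℝ, 0 ≤ c₀ ∧ ∀ c' : ℝ, c₀ ≤ c' → Eq128 c' := by
  obtain ⟨c₀, h0, h⟩ := partOne_eventually
  exact ⟨c₀, h0, fun c' hc' =>
    eq128_of_inputs c' prop22i_holds (h c' hc').2.1 (h c' hc').2.2.1
      (Section7cStatements.prop71X_holds c')⟩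

end Literature.NumberTheory.LFunctions.Zhang2022.Typed.Sec12A
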